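import Mathlib.NumberTheory.PrimeCounting
import Mathlib.Analysis.SpecialFunctions.Log.Basic
import HarnessLib

/-!
# Axler 2016, Corollary 3.4 (last display): `π(x) < x/(log x − 1 − 1.17/log x)` for every `x ≥ 5.43`

Topic `Literature/NumberTheory/LFunctions` (home of the tree's explicit prime-counting / Chebyshev-function
facts: `Dusart2010_theta_thm_5_2`, `Buthe2018_thm2_theta`, `BroadbentEtAl2021_theta_rel_1e19`,
`FioriKadiriSwidinsky2023_*`). One published, unconditional, partly computer-assisted upper bound for the
prime counting function, vendored as a NAMED FACT exactly as printed (D-0014: `def … : Prop`, nothing is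
asserted; users take `(h : Axler2016_cor34_primeCounting_lt)`), plus the one elementary consequence the
requester needs, PROVED from it.

* `Axler2016_cor34_primeCounting_lt` — C. Axler, *New bounds for the prime counting function*, Integers
  **16** (2016), Paper A22, **Corollary 3.4, last display** (journal p. 8; = Corollary 3.5 of the arXiv text
  1409.1780, `[corpus:paper:arxiv-1409.1780 p0006:L77–79]`, `[corpus:paper:doi-10-5281-zenodo-10474451
  p0008]`): "If `x ≥ 5.43`, then `π(x) < x/(log x − 1 − 1.17/log x)`." Restated unchanged by the author in
  arXiv:1711.04588, display (5.1) ("the right-hand side inequality holds for every `x ≥ 5.43`"). Proof in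
  the source: comparison with Axler's Theorem 1.1 (an upper bound of the same shape with more terms, from
  explicit `θ`-estimates) for large `x`, computer check for small `x`.
* `Axler2016_cor34_primeCounting_lt.le_mul_div_log` — PROVED: for `c > 1` and `x ≥ 5.43` with
  `c·(1 + 1.17/log x) ≤ (c − 1)·log x` one has `π(x) ≤ c·x/log x`. This is the form in which the fact is
  consumed by Mochizuki–Fesenko–Hoshi–Minamide–Porowski, Kodai Math. J. 45 (2022), Prop. 2.2 (i)
  ("`π(x) ≤ 1.022·x/log(x)` for `x ≥ 5·10^20`", proved there from exactly this corollary; typed in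
  `Literature/IUT/LogVolume/ExplicitEstimatesPrimeNumberTheorem.lean`).

Conventions: `π(x)` for real `x` is `Nat.primeCounting ⌊x⌋₊` (the number of primes `≤ x`), as in the
tree's `Literature.IUT.LogVolume.IsEtaPrm`; `log` is `Real.log`. For `x ≥ 5.43` the printed denominator
`log x − 1 − 1.17/log x` is positive (`log 5.43 = 1.6919…`, value `≈ 4·10⁻⁴`), so no junk division occurs in
the printed range; this positivity is not needed below and is not asserted.

Deliberately NOT here: the three sharper displays of Corollary 3.4 (`x ≥ 21.95`, `x ≥ 14.36`, `x ≥ 9.25`,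
denominators with `log⁻²`, `log⁻³`, `log⁻⁴` terms) and Axler's lower bounds (Cor. 3.6) — no requester;
TODO(general form). Searched first: the tree has NO explicit upper bound for `π(x)` with a second-order
term (`lean search 'Axler|Dusart|1.2762|1.25506'`: only `θ`/`ψ`-facts), and the `θ`-facts it has do not
give `1.022` at `log x = 47.66` by partial summation within kernel-provable margins.

## References

* [Axler2016] C. Axler, *New bounds for the prime counting function*, Integers 16 (2016), A22, Cor. 3.4
  (doi 10.5281/zenodo.10474451; arXiv:1409.1780, there Cor. 3.5).
* [MochizukiEtAl2022] S. Mochizuki, I. Fesenko, Y. Hoshi, A. Minamide, W. Porowski, Kodai Math. J. 45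
  (2022) 175–236, Prop. 2.2 (i) (the requester).
-/

noncomputable section

namespace Literature.NumberTheory.LFunctions

open Real
open scoped Nat.Prime

/-! ### The named fact -/

/-- NAMED FACT (Axler 2016, Corollary 3.4, last display, as printed): "If `x ≥ 5.43`, then
`π(x) < x/(log x − 1 − 1.17/log x)`." Here `π(x) = Nat.primeCounting ⌊x⌋₊`. Unconditional. Users take
`(h : Axler2016_cor34_primeCounting_lt)`. [cite: Axler2016, Cor. 3.4 (last display), p. 8] -/
def Axler2016_cor34_primeCounting_lt : Prop :=
  ∀ x : ℝ, 5.43 ≤ x → (π ⌊x⌋₊ : ℝ) < x / (Real.log x - 1 - 1.17 / Real.log x)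

/-! ### Elementary consequence (proved) -/

namespace Axler2016_cor34_primeCounting_lt

/-- The form `π(x) ≤ c·x/log x`: if `c > 1`, `x ≥ 5.43` and `c·(1 + 1.17/log x) ≤ (c − 1)·log x` (equivalently
`log x ≤ c·(log x − 1 − 1.17/log x)`), then `π(x) ≤ c·x/log(x)`. PROVED from the fact (for such `x` the printed
denominator is at least `log(x)/c > 0`). [cite: Axler2016, Cor. 3.4 (last display), p. 8] -/
theorem le_mul_div_log (h : Axler2016_cor34_primeCounting_lt) {x c : ℝ} (hx : 5.43 ≤ x) (hc : 1 < c)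
    (hlog : c * (1 + 1.17 / Real.log x) ≤ (c - 1) * Real.log x) :
    (π ⌊x⌋₊ : ℝ) ≤ c * x / Real.log x := by
  have hx0 : 0 < x := lt_of_lt_of_le (by norm_num) hx
  have hL : 0 < Real.log x := Real.log_pos (lt_of_lt_of_le (by norm_num) hx)
  have hc0 : 0 < c := lt_trans zero_lt_one hc
  set L := Real.log x with hLdef
  -- the printed denominator `D = L − 1 − 1.17/L` satisfies `c·D ≥ L`, hence `D ≥ L/c > 0`
  have hD : L ≤ c * (L - 1 - 1.17 / L) := by
    have e : c * (L - 1 - 1.17 / L) = c * L - c * (1 + 1.17 / L) := by ring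
    rw [e]; linarith
  have hDpos : 0 < L - 1 - 1.17 / L := by
    by_contra hneg
    push Not at hneg
    have : c * (L - 1 - 1.17 / L) ≤ 0 := mul_nonpos_of_nonneg_of_nonpos hc0.le hneg
    linarith
  have h1 := h x hx
  -- `x/D ≤ x/(L/c) = c·x/L`
  have h2 : x / (L - 1 - 1.17 / L) ≤ c * x / L := by
    rw [div_le_div_iff₀ hDpos hL]
    have := mul_le_mul_of_nonneg_left hD hx0.le
    calc x * L ≤ x * (c * (L - 1 - 1.17 / L)) := this
      _ = c * x * (L - 1 - 1.17 / L) := by ring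
  exact le_trans h1.le h2

end Axler2016_cor34_primeCounting_lt

end Literature.NumberTheory.LFunctions

end
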